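import Literature.IUT.HodgeTheaters.PseudoMonoidDivisibleCyclotomic
import Literature.IUT.HodgeTheaters.KappaCoricGalois
import Literature.IUT.HodgeTheaters.KappaCoricFunctionsProofs
import HarnessLib

/-!
# [IUTchI] Remark 3.1.7 (ii), p. 68: the pseudo-monoids of `∞κ`- and `∞κ×`-coric elements are DIVISIBLE and
# CYCLOTOMIC, and the invertible `∞κ×`-coric elements are the constants — proved at the model
# (proof-only companion of `KappaCoricFunctions` / `KappaCoricGalois`)

S. Mochizuki, *Inter-universal Teichmüller theory I*, kurims manuscript (May 2020), §3 Remark 3.1.7 (ii) p. 68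
l. 1–4: "Finally, one verifies immediately that the operation of multiplication determines a structure of
pseudo-monoid [cf. §0] on the sets of `κ`-, `∞κ`-, and `∞κ×`-coric rational functions; moreover, in the case of
`∞κ`- and `∞κ×`-coric rational functions, the resulting pseudo-monoid is *divisible* and *cyclotomic*" (used
"in discussions concerning the Kummer theory of rational functions on `C_L` [cf. Example 5.1, (i), (v);
Definition 5.2, (v), (vi), (vii), (viii)]") ([IUTchI] Rmk 3.1.7 (ii) p.68) [claim: Mochizuki2012, status: disputed]
(D-0012 claim key, series status DISPUTED — the content here is elementary field theory at abc-iut-L5-t2's MODEL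
of the coric functions; nothing disputed is involved and no side is taken on [IUTchIII] Cor. 3.12).

## What is proved (node IUTchI:Rmk3.1.7(ii); the typer's header of `KappaCoricFunctions.lean` lists "the
pseudo-monoid structures (p. 68, [IUTchI] §0)" among the items NOT typed there)

Setting of abc-iut-L5-t2's general form (`KappaCoricGalois.lean`): `Ω` a field of characteristic `0` (`L̄`),
`S : CriticalLocus Ω`, `Λ ⊇ Ω(t)` a field (`L̄_C`, an algebraic closure of the function field `L_C`), `∞κ`-coric
(`CriticalLocus.IsInftyKappaCoricIn`: "`fⁿ` is a `κ`-coric element of `L_C`") and `∞κ×`-coric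
(`IsInftyKappaUnitCoricIn`, parameter `U = U_L`) ELEMENTS OF `Λ`; the pseudo-monoids are the subsets of the
abelian group `M := Λˣ` with the restricted multiplication (abc-iut-L5-t1's `PartialMul.ofSubset`, §0 p. 33;
the `κ`-coric clause "pseudo-monoid" is `PartialMul.isPseudoMonoid_ofSubset` by name), and the printed
adjectives are abc-iut-L5-t1's `PartialMul.IsDivisible` / `PartialMul.IsCyclotomic`, reached through the
criteria and the lemma `μ(Λ) ≅ ℚ/ℤ` of `PseudoMonoidDivisibleCyclotomic.lean`.

* `CriticalLocus.isDivisible_inftyKappaCoric`, `isCyclotomic_inftyKappaCoric` — **the `∞κ`-coric pseudo-monoid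
  is divisible and cyclotomic** (`Λ` algebraically closed; `a` is `∞κ`-coric iff `aⁿ` is, by `IsKappaCoric.pow`;
  roots of unity are `∞κ`-coric and act on `∞κ`-coric elements).
* `CriticalLocus.isDivisible_inftyKappaUnitCoric`, `isCyclotomic_inftyKappaUnitCoric` — **the `∞κ×`-coric
  pseudo-monoid is divisible and cyclotomic**, for a unit parameter `U` closed under powers and under `n`-th
  roots and containing `1` (as `U_L = L̄^×`, resp. the units of `L̄`, are — `L̄` algebraically closed); and the
  instance `U = Ω ∖ {0}` for `Ω` algebraically closed (`isDivisible_isCyclotomic_inftyKappaUnitCoric_ne_zero`).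
* `CriticalLocus.IsKappaCoric.exists_eq_C_of_mul_eq_C` — two `κ`-coric functions with constant product are
  constant (the divisor form of Rmk 3.1.7 (i) "never both `f` and `f⁻¹` are `κ`-coric", p. 67);
  `exists_pow_eq_C_of_isInftyKappaUnitCoricIn_inv`, **`isInftyKappaUnitCoricIn_and_inv_iff_eq_C`** — the model
  form of [IUTchI] Ex 5.1 (v) p. 128 "`(𝕄^⊛_∞κ×(†𝒟^⊚))^× = 𝕄^⊛(†𝒟^⊚)`" (sub-DAG row E51/L30): for `Ω` algebraically
  closed and `U_L = Ω ∖ {0}`, `x` and `x⁻¹` are both `∞κ×`-coric iff `x` is a nonzero constant.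

PROOF-ONLY: no definition, no instance, no notation.  typed ≠ proved elsewhere.
-/

namespace Literature.IUT.HodgeTheaters

universe u v

/-! ### Rmk 3.1.7 (ii) p. 68 at the model: the `∞κ`-coric pseudo-monoid -/

namespace CriticalLocus

open Polynomial

variable {Ω : Type u} [Field Ω] [CharZero Ω] (S : CriticalLocus Ω) (Λ : Type v) [Field Λ]
  [Algebra (RatFunc Ω) Λ]

/-- The constant `1` is `κ`-coric (all conditions are vacuous or read `1 ≠ 0`, `1¹ = 1`).
([IUTchI] Rmk 3.1.7 (i) p.67) [claim: Mochizuki2012, status: disputed] -/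
private theorem isKappaCoric_one' : S.IsKappaCoric (1 : RatFunc Ω) := by
  refine ⟨fun h => absurd (map_one RatFunc.C).symm (h 1), fun z hz => ?_,
    ⟨fun e _ => ?_, fun e _ => ?_, ?_⟩, fun e _ => ⟨1, Nat.one_pos, ?_⟩⟩
  · simp [zeroes, poles] at hz
  · simp
  · simp
  · simp
  · simp

/-- `∞κ`-coric elements are closed under `n`-th powers and `n`-th roots (`n ≥ 1`): "`a ∈ ι(P)` iff `aⁿ ∈ ι(P)`"
(§0 p. 33) for the `∞κ`-coric pseudo-monoid — powers of `κ`-coric functions are `κ`-coric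
(`IsKappaCoric.pow`). ([IUTchI] Rmk 3.1.7 (ii) p.68) [claim: Mochizuki2012, status: disputed] -/
theorem isInftyKappaCoricIn_pow_iff {n : ℕ} (hn : 0 < n) (a : Λ) :
    S.IsInftyKappaCoricIn Λ (a ^ n) ↔ S.IsInftyKappaCoricIn Λ a := by
  constructor
  · rintro ⟨m, hm, g, hg, h⟩
    exact ⟨n * m, Nat.mul_pos hn hm, g, hg, by rw [pow_mul, h]⟩
  · rintro ⟨m, hm, g, hg, h⟩
    exact ⟨m, hm, g ^ n, hg.pow S hn, by rw [← pow_mul, mul_comm, pow_mul, h, map_pow]⟩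

/-- Roots of unity of `Λ` are `∞κ`-coric (`ζⁿ = 1` is `κ`-coric): "`μ_M ⊆ ι(P)`" (§0 p. 33).
([IUTchI] Rmk 3.1.7 (ii) p.68) [claim: Mochizuki2012, status: disputed] -/
theorem isInftyKappaCoricIn_of_pow_eq_one {ζ : Λ} {n : ℕ} (hn : 0 < n) (h : ζ ^ n = 1) :
    S.IsInftyKappaCoricIn Λ ζ :=
  ⟨n, hn, 1, S.isKappaCoric_one', by rw [h, map_one]⟩

/-- `∞κ`-coric elements are stable under multiplication by roots of unity: "`μ_M · ι(P) ⊆ ι(P)`" (§0 p. 33).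
([IUTchI] Rmk 3.1.7 (ii) p.68) [claim: Mochizuki2012, status: disputed] -/
theorem isInftyKappaCoricIn_mul_of_pow_eq_one {ζ a : Λ} {n : ℕ} (hn : 0 < n) (h : ζ ^ n = 1)
    (ha : S.IsInftyKappaCoricIn Λ a) : S.IsInftyKappaCoricIn Λ (ζ * a) := by
  obtain ⟨m, hm, g, hg, hga⟩ := ha
  refine ⟨n * m, Nat.mul_pos hn hm, g ^ n, hg.pow S hn, ?_⟩
  rw [mul_pow, pow_mul, h, one_pow, one_mul, pow_mul', hga, map_pow]

/-- **[IUTchI] Rmk 3.1.7 (ii) p. 68: the pseudo-monoid of `∞κ`-coric elements of `L̄_C` is DIVISIBLE** — for `Λ`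
algebraically closed, realised in `M := Λˣ` (every element has `n`-th roots; `a` is `∞κ`-coric iff `aⁿ` is).
([IUTchI] Rmk 3.1.7 (ii) p.68) [claim: Mochizuki2012, status: disputed] -/
theorem isDivisible_inftyKappaCoric [IsAlgClosed Λ] :
    (PartialMul.ofSubset {x : Λˣ | S.IsInftyKappaCoricIn Λ (x : Λ)}).IsDivisible := by
  refine PartialMul.isDivisible_ofSubset _ (fun n hn a => ?_) (fun n hn a => ?_)
  · obtain ⟨z, hz⟩ := IsAlgClosed.exists_pow_nat_eq (a : Λ) hn
    have hz0 : z ≠ 0 := fun h0 => a.ne_zero (by rw [← hz, h0, zero_pow hn.ne'])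
    exact ⟨Units.mk0 z hz0, Units.ext (by rw [Units.val_pow_eq_pow_val, Units.val_mk0, hz])⟩
  · change S.IsInftyKappaCoricIn Λ (a : Λ) ↔ S.IsInftyKappaCoricIn Λ ((a ^ n : Λˣ) : Λ)
    rw [Units.val_pow_eq_pow_val, S.isInftyKappaCoricIn_pow_iff Λ hn]

/-- **[IUTchI] Rmk 3.1.7 (ii) p. 68: the pseudo-monoid of `∞κ`-coric elements of `L̄_C` is CYCLOTOMIC** — for `Λ`
algebraically closed (of characteristic `0`, as `Λ ⊇ Ω(t) ⊇ ℚ`): `μ(Λ) ≅ ℚ/ℤ` (`nonempty_torsion_mulEquiv_qModZ`),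
roots of unity are `∞κ`-coric, and `∞κ`-coric elements are stable under roots of unity.
([IUTchI] Rmk 3.1.7 (ii) p.68) [claim: Mochizuki2012, status: disputed] -/
theorem isCyclotomic_inftyKappaCoric [IsAlgClosed Λ] :
    (PartialMul.ofSubset {x : Λˣ | S.IsInftyKappaCoricIn Λ (x : Λ)}).IsCyclotomic := by
  haveI : CharZero Λ :=
    (RingHom.charZero_iff (algebraMap (RatFunc Ω) Λ).injective).1 inferInstance
  refine PartialMul.isCyclotomic_ofSubset _ (nonempty_torsion_mulEquiv_qModZ Λ) (fun t ht => ?_)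
    (fun t ht a ha => ?_)
  · rw [SetLike.mem_coe, CommGroup.mem_torsion, isOfFinOrder_iff_pow_eq_one] at ht
    obtain ⟨n, hn, htn⟩ := ht
    exact S.isInftyKappaCoricIn_of_pow_eq_one Λ hn (by rw [← Units.val_pow_eq_pow_val, htn, Units.val_one])
  · rw [CommGroup.mem_torsion, isOfFinOrder_iff_pow_eq_one] at ht
    obtain ⟨n, hn, htn⟩ := ht
    change S.IsInftyKappaCoricIn Λ ((t * a : Λˣ) : Λ)
    rw [Units.val_mul]
    exact S.isInftyKappaCoricIn_mul_of_pow_eq_one Λ hn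
      (by rw [← Units.val_pow_eq_pow_val, htn, Units.val_one]) ha

/-! ### Rmk 3.1.7 (ii) p. 68 at the model: the `∞κ×`-coric pseudo-monoid -/

/-- `∞κ×`-coric elements are closed under `n`-th powers and `n`-th roots (`n ≥ 1`) when the unit parameter `U`
is closed under `n`-th powers and `n`-th roots (as `U_L = L̄^×`, resp. the units of `L̄`, is).
([IUTchI] Rmk 3.1.7 (ii) p.68) [claim: Mochizuki2012, status: disputed] -/
theorem isInftyKappaUnitCoricIn_pow_iff {U : Set Ω} (hUpow : ∀ c ∈ U, ∀ n : ℕ, c ^ n ∈ U)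
    (hUroot : ∀ c ∈ U, ∀ n : ℕ, 0 < n → ∃ d ∈ U, d ^ n = c) {n : ℕ} (hn : 0 < n) (a : Λ) :
    S.IsInftyKappaUnitCoricIn Λ U (a ^ n) ↔ S.IsInftyKappaUnitCoricIn Λ U a := by
  constructor
  · rintro ⟨c, hc, h⟩
    obtain ⟨d, hd, rfl⟩ := hUroot c hc n hn
    refine ⟨d, hd, (S.isInftyKappaCoricIn_pow_iff Λ hn _).1 ?_⟩
    rwa [mul_pow, ← map_pow, ← map_pow]
  · rintro ⟨c, hc, h⟩
    refine ⟨c ^ n, hUpow c hc n, ?_⟩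
    rw [map_pow, map_pow, ← mul_pow]
    exact (S.isInftyKappaCoricIn_pow_iff Λ hn _).2 h

/-- **[IUTchI] Rmk 3.1.7 (ii) p. 68: the pseudo-monoid of `∞κ×`-coric elements of `L̄_C` is DIVISIBLE** — for `Λ`
algebraically closed and a unit parameter `U` closed under powers and roots, realised in `M := Λˣ`.
([IUTchI] Rmk 3.1.7 (ii) p.68) [claim: Mochizuki2012, status: disputed] -/
theorem isDivisible_inftyKappaUnitCoric [IsAlgClosed Λ] {U : Set Ω} (hUpow : ∀ c ∈ U, ∀ n : ℕ, c ^ n ∈ U)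
    (hUroot : ∀ c ∈ U, ∀ n : ℕ, 0 < n → ∃ d ∈ U, d ^ n = c) :
    (PartialMul.ofSubset {x : Λˣ | S.IsInftyKappaUnitCoricIn Λ U (x : Λ)}).IsDivisible := by
  refine PartialMul.isDivisible_ofSubset _ (fun n hn a => ?_) (fun n hn a => ?_)
  · obtain ⟨z, hz⟩ := IsAlgClosed.exists_pow_nat_eq (a : Λ) hn
    have hz0 : z ≠ 0 := fun h0 => a.ne_zero (by rw [← hz, h0, zero_pow hn.ne'])
    exact ⟨Units.mk0 z hz0, Units.ext (by rw [Units.val_pow_eq_pow_val, Units.val_mk0, hz])⟩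
  · change S.IsInftyKappaUnitCoricIn Λ U (a : Λ) ↔ S.IsInftyKappaUnitCoricIn Λ U ((a ^ n : Λˣ) : Λ)
    rw [Units.val_pow_eq_pow_val, S.isInftyKappaUnitCoricIn_pow_iff Λ hUpow hUroot hn]

/-- **[IUTchI] Rmk 3.1.7 (ii) p. 68: the pseudo-monoid of `∞κ×`-coric elements of `L̄_C` is CYCLOTOMIC** — for `Λ`
algebraically closed and a unit parameter `U ∋ 1`: `μ(Λ) ≅ ℚ/ℤ`, roots of unity are `∞κ×`-coric (`c = 1`), and
`∞κ×`-coric elements are stable under roots of unity.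
([IUTchI] Rmk 3.1.7 (ii) p.68) [claim: Mochizuki2012, status: disputed] -/
theorem isCyclotomic_inftyKappaUnitCoric [IsAlgClosed Λ] {U : Set Ω} (hU1 : (1 : Ω) ∈ U) :
    (PartialMul.ofSubset {x : Λˣ | S.IsInftyKappaUnitCoricIn Λ U (x : Λ)}).IsCyclotomic := by
  haveI : CharZero Λ :=
    (RingHom.charZero_iff (algebraMap (RatFunc Ω) Λ).injective).1 inferInstance
  refine PartialMul.isCyclotomic_ofSubset _ (nonempty_torsion_mulEquiv_qModZ Λ) (fun t ht => ?_)
    (fun t ht a ha => ?_)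
  · rw [SetLike.mem_coe, CommGroup.mem_torsion, isOfFinOrder_iff_pow_eq_one] at ht
    obtain ⟨n, hn, htn⟩ := ht
    refine ⟨1, hU1, ?_⟩
    rw [map_one, map_one, one_mul]
    exact S.isInftyKappaCoricIn_of_pow_eq_one Λ hn (by rw [← Units.val_pow_eq_pow_val, htn, Units.val_one])
  · rw [CommGroup.mem_torsion, isOfFinOrder_iff_pow_eq_one] at ht
    obtain ⟨n, hn, htn⟩ := ht
    obtain ⟨c, hc, h⟩ := ha
    refine ⟨c, hc, ?_⟩
    change S.IsInftyKappaCoricIn Λ (_ * ((t * a : Λˣ) : Λ))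
    rw [Units.val_mul, mul_left_comm]
    exact S.isInftyKappaCoricIn_mul_of_pow_eq_one Λ hn
      (by rw [← Units.val_pow_eq_pow_val, htn, Units.val_one]) h

/-- The instance `U_L = L̄ ∖ {0}` (all nonzero constants of an algebraically closed `Ω`): the `∞κ×`-coric
pseudo-monoid is divisible and cyclotomic. ([IUTchI] Rmk 3.1.7 (ii) p.68) [claim: Mochizuki2012, status: disputed] -/
theorem isDivisible_isCyclotomic_inftyKappaUnitCoric_ne_zero [IsAlgClosed Ω] [IsAlgClosed Λ] :
    (PartialMul.ofSubset {x : Λˣ | S.IsInftyKappaUnitCoricIn Λ {c : Ω | c ≠ 0} (x : Λ)}).IsDivisible ∧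
      (PartialMul.ofSubset {x : Λˣ | S.IsInftyKappaUnitCoricIn Λ {c : Ω | c ≠ 0} (x : Λ)}).IsCyclotomic := by
  refine ⟨S.isDivisible_inftyKappaUnitCoric Λ (fun c hc n => pow_ne_zero n hc) (fun c hc n hn => ?_),
    S.isCyclotomic_inftyKappaUnitCoric Λ one_ne_zero⟩
  obtain ⟨d, hd⟩ := IsAlgClosed.exists_pow_nat_eq c hn
  exact ⟨d, fun h0 => hc (by rw [← hd, h0, zero_pow hn.ne']), hd⟩

/-! ### Ex 5.1 (v) p. 128 / Rmk 3.1.7 (i) p. 67 at the model: the invertible `∞κ×`-coric elements are the constants -/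

/-- Two `κ`-coric rational functions whose product is a nonzero constant are constant: a non-constant `κ`-coric
`G` has "precisely one pole, but at least two distinct zeroes" (Rmk 3.1.7 (i)); from `G·G' = k` every zero of `G`
is a pole of `G'`, so `G'` would have at least two poles.  (The divisor form of "it is never the case that both
`f` and `f⁻¹` are `κ`-coric", p. 67.) ([IUTchI] Rmk 3.1.7 (i) p.67) [claim: Mochizuki2012, status: disputed] -/
theorem IsKappaCoric.exists_eq_C_of_mul_eq_C {G G' : RatFunc Ω} (hG : S.IsKappaCoric G)
    (hG' : S.IsKappaCoric G') {k : Ω} (hk : k ≠ 0) (h : G * G' = RatFunc.C k) : ∃ a : Ω, G = RatFunc.C a := by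
  classical
  by_contra hne
  rw [not_exists] at hne
  obtain ⟨-, hz2⟩ := hG.one_pole_two_zeroes hne
  -- `G'` is not constant either
  have hne' : ∀ a : Ω, G' ≠ RatFunc.C a := by
    intro a ha
    have ha0 : a ≠ 0 := by
      rintro rfl
      rw [ha, map_zero, mul_zero] at h
      exact (_root_.map_ne_zero RatFunc.C).2 hk h.symm
    apply hne (k / a)
    rw [map_div₀, ← h, ha, mul_div_assoc, div_self ((_root_.map_ne_zero RatFunc.C).2 ha0), mul_one]
  obtain ⟨hp1', -⟩ := hG'.one_pole_two_zeroes hne'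
  -- the divisor identity `num G · num G' = k · denom G · denom G'`
  have hnd : G.num * G'.num = Polynomial.C k * (G.denom * G'.denom) := by
    have := RatFunc.num_denom_mul G G'
    rw [h, RatFunc.num_C, RatFunc.denom_C, mul_one] at this
    rw [this]
  -- every zero of `G` is a pole of `G'`
  have hsub : zeroes G ⊆ poles G' := by
    intro z hz
    rw [zeroes, Multiset.mem_toFinset, Polynomial.mem_roots (RatFunc.num_ne_zero (hG.ne_zero S))] at hz
    rw [poles, Multiset.mem_toFinset, Polynomial.mem_roots (RatFunc.denom_ne_zero G')]
    have h1 : Polynomial.eval z (G.num * G'.num) = 0 := by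
      rw [Polynomial.eval_mul, hz.eq_zero, zero_mul]
    rw [hnd, Polynomial.eval_mul, Polynomial.eval_mul, Polynomial.eval_C] at h1
    rcases mul_eq_zero.1 h1 with h2 | h2
    · exact absurd h2 hk
    rcases mul_eq_zero.1 h2 with h3 | h3
    · -- `num G` and `denom G` have no common zero
      exfalso
      obtain ⟨a, b, hab⟩ := RatFunc.isCoprime_num_denom G
      have := congrArg (Polynomial.eval z) hab
      rw [Polynomial.eval_add, Polynomial.eval_mul, Polynomial.eval_mul, hz.eq_zero, h3, mul_zero, mul_zero,
        add_zero, Polynomial.eval_one] at this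
      exact zero_ne_one this
    · exact h3
  have := (Finset.card_le_card hsub).trans_eq hp1'
  omega

/-- **Units of the `∞κ×`-coric pseudo-monoid are (roots of) constants** (Ex 5.1 (v) p. 128:
"`(𝕄^⊛_∞κ(†𝒟^⊚))^× ⊆ (𝕄^⊛_∞κ×(†𝒟^⊚))^× = 𝕄^⊛(†𝒟^⊚)`", at the model): if `x` and `x⁻¹` are both `∞κ×`-coric then
some positive power of `x` is a nonzero constant.  (No hypothesis on `U`; a parameter `c = 0` cannot occur since
`κ`-coric functions are nonzero.) ([IUTchI] Ex 5.1 (v) p.128) [claim: Mochizuki2012, status: disputed] -/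
theorem exists_pow_eq_C_of_isInftyKappaUnitCoricIn_inv {U : Set Ω} {x : Λ}
    (h₁ : S.IsInftyKappaUnitCoricIn Λ U x) (h₂ : S.IsInftyKappaUnitCoricIn Λ U x⁻¹) :
    ∃ N : ℕ, 0 < N ∧ ∃ a : Ω, a ≠ 0 ∧ x ^ N = algebraMap (RatFunc Ω) Λ (RatFunc.C a) := by
  obtain ⟨c, -, m, hm, g, hg, hgx⟩ := h₁
  obtain ⟨c', -, m', hm', g', hg', hgx'⟩ := h₂
  have hinj := (algebraMap (RatFunc Ω) Λ).injective
  -- the parameters are nonzero and `x ≠ 0`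
  have hc : c ≠ 0 := by
    rintro rfl
    rw [map_zero, map_zero, zero_mul, zero_pow hm.ne', eq_comm, map_eq_zero_iff _ hinj] at hgx
    exact hg.ne_zero S hgx
  have hc' : c' ≠ 0 := by
    rintro rfl
    rw [map_zero, map_zero, zero_mul, zero_pow hm'.ne', eq_comm, map_eq_zero_iff _ hinj] at hgx'
    exact hg'.ne_zero S hgx'
  have hx : x ≠ 0 := by
    rintro rfl
    rw [mul_zero, zero_pow hm.ne', eq_comm, map_eq_zero_iff _ hinj] at hgx
    exact hg.ne_zero S hgx
  -- `g^{m'} · g'^{m} = (c c')^{m m'}`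
  have e1 : algebraMap (RatFunc Ω) Λ (g ^ m' * g' ^ m) =
      ((algebraMap (RatFunc Ω) Λ (RatFunc.C c) * x) * (algebraMap (RatFunc Ω) Λ (RatFunc.C c') * x⁻¹)) ^
        (m * m') := by
    rw [map_mul, map_pow, map_pow, ← hgx, ← hgx', ← pow_mul, ← pow_mul, mul_comm m' m, ← mul_pow]
  have e2 : (algebraMap (RatFunc Ω) Λ (RatFunc.C c) * x) * (algebraMap (RatFunc Ω) Λ (RatFunc.C c') * x⁻¹) =
      algebraMap (RatFunc Ω) Λ (RatFunc.C (c * c')) := by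
    rw [mul_mul_mul_comm, mul_inv_cancel₀ hx, mul_one, ← map_mul, ← map_mul]
  have hprod : g ^ m' * g' ^ m = RatFunc.C ((c * c') ^ (m * m')) := by
    apply hinj
    rw [e1, e2, ← map_pow, ← map_pow]
  obtain ⟨a, ha⟩ := IsKappaCoric.exists_eq_C_of_mul_eq_C S (hg.pow S hm') (hg'.pow S hm)
    (pow_ne_zero _ (mul_ne_zero hc hc')) hprod
  have ha0 : a ≠ 0 := by
    rintro rfl
    rw [map_zero, pow_eq_zero_iff hm'.ne'] at ha
    exact hg.ne_zero S ha
  -- `x^{m m'} = a / c^{m m'}`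
  refine ⟨m * m', Nat.mul_pos hm hm', a / c ^ (m * m'), div_ne_zero ha0 (pow_ne_zero _ hc), ?_⟩
  have h1 : (algebraMap (RatFunc Ω) Λ (RatFunc.C c) * x) ^ (m * m') = algebraMap (RatFunc Ω) Λ (RatFunc.C a) := by
    rw [pow_mul, hgx, ← map_pow, ha]
  have hcm : algebraMap (RatFunc Ω) Λ (RatFunc.C (c ^ (m * m'))) ≠ 0 := by
    rw [map_ne_zero_iff _ hinj, _root_.map_ne_zero RatFunc.C]; exact pow_ne_zero _ hc
  rw [mul_pow, ← map_pow, ← map_pow] at h1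
  rw [map_div₀, map_div₀, eq_div_iff hcm, mul_comm (x ^ (m * m'))]
  exact h1

/-- A nonzero constant `a` (resp. its inverse) is `∞κ×`-coric as soon as `a⁻¹ ∈ U` (resp. `a ∈ U`): `a⁻¹·a = 1`
is `κ`-coric. ([IUTchI] Ex 5.1 (v) p.128) [claim: Mochizuki2012, status: disputed] -/
theorem isInftyKappaUnitCoricIn_C {U : Set Ω} {a : Ω} (ha : a ≠ 0) (haU : a⁻¹ ∈ U) :
    S.IsInftyKappaUnitCoricIn Λ U (algebraMap (RatFunc Ω) Λ (RatFunc.C a)) :=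
  ⟨a⁻¹, haU, 1, Nat.one_pos, 1, S.isKappaCoric_one', by
    rw [pow_one, ← map_mul, ← map_mul, inv_mul_cancel₀ ha, map_one]⟩

/-- **"`(𝕄^⊛_∞κ×)^× = 𝕄^⊛`" at the model** (Ex 5.1 (v) p. 128; Ex 5.1 (i) p. 124 "`𝕄^⊛` … may be identified with a
certain sub-pseudo-monoid of `𝕄^⊛_∞κ×`"): for `Ω` algebraically closed and `U_L = Ω ∖ {0}`, an element `x` of
`Λ ⊇ Ω(t)` is an invertible element of the `∞κ×`-coric pseudo-monoid (`x` and `x⁻¹` both `∞κ×`-coric) iff `x` is a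
nonzero constant. ([IUTchI] Ex 5.1 (v) p.128) [claim: Mochizuki2012, status: disputed] -/
theorem isInftyKappaUnitCoricIn_and_inv_iff_eq_C [IsAlgClosed Ω] (x : Λ) :
    (S.IsInftyKappaUnitCoricIn Λ {c : Ω | c ≠ 0} x ∧ S.IsInftyKappaUnitCoricIn Λ {c : Ω | c ≠ 0} x⁻¹) ↔
      ∃ a : Ω, a ≠ 0 ∧ x = algebraMap (RatFunc Ω) Λ (RatFunc.C a) := by
  constructor
  · rintro ⟨h₁, h₂⟩
    obtain ⟨N, hN, b, hb, hxN⟩ := S.exists_pow_eq_C_of_isInftyKappaUnitCoricIn_inv Λ h₁ h₂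
    -- `x` is a root of `X^N - b`, which splits over `Ω`
    have hsplit := IsAlgClosed.splits (Polynomial.X ^ N - Polynomial.C b : Polynomial Ω)
    have hmonic : (Polynomial.X ^ N - Polynomial.C b : Polynomial Ω).Monic :=
      Polynomial.monic_X_pow_sub_C b hN.ne'
    have hprod := hsplit.eq_prod_roots_of_monic hmonic
    have heval : Polynomial.eval₂ ((algebraMap (RatFunc Ω) Λ).comp RatFunc.C) x
        (Polynomial.X ^ N - Polynomial.C b) = 0 := by
      rw [Polynomial.eval₂_sub, Polynomial.eval₂_X_pow, Polynomial.eval₂_C, hxN, RingHom.comp_apply, sub_self]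
    rw [hprod, Polynomial.eval₂_multiset_prod, Multiset.map_map, Multiset.prod_eq_zero_iff, Multiset.mem_map]
      at heval
    obtain ⟨ρ, hρ, hρx⟩ := heval
    rw [Function.comp_apply, Polynomial.eval₂_sub, Polynomial.eval₂_X, Polynomial.eval₂_C, sub_eq_zero,
      RingHom.comp_apply] at hρx
    refine ⟨ρ, ?_, hρx⟩
    rintro rfl
    rw [Polynomial.mem_roots hmonic.ne_zero, Polynomial.IsRoot.def, Polynomial.eval_sub, Polynomial.eval_pow,
      Polynomial.eval_X, Polynomial.eval_C, zero_pow hN.ne', zero_sub, neg_eq_zero] at hρ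
    exact hb hρ
  · rintro ⟨a, ha, rfl⟩
    refine ⟨S.isInftyKappaUnitCoricIn_C Λ ha (inv_ne_zero ha), ?_⟩
    rw [← map_inv₀, ← map_inv₀]
    exact S.isInftyKappaUnitCoricIn_C Λ (inv_ne_zero ha) (by rw [inv_inv]; exact ha)

end CriticalLocus

end Literature.IUT.HodgeTheaters
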